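import Literature.MathematicalPhysics.QuantumFieldTheory.Balaban1983to89.B6

/-!
# [B6] Proposition 2.6 for the Dirichlet operators G(Ω), Ω ⊃ Ω₁ — the named printed assertion `B6.Prop26DirichletPrinted`

statement-level skeleton of published theorems with citation tags; proofs where landed; nothing here is a claim
about the Yang–Mills mass gap.

T. Bałaban, *Propagators and renormalization transformations for lattice gauge theories. II*, Commun. Math.
Phys. **96** (1984) 223–250 [Balaban1984PropagatorsII] (= [B6]; journal page = PDF page + 222), p. 228 [PDF 6]
after (2.35) and p. 248 [PDF 26] ll. 4–5 (after Proposition 2.6), read first-hand on the ×2 page renders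
`run/shared/lean/pub/pub-balaban/b2b-balaban-ref1/pages/` and the text layer.  Cell lit-balaban, Literature lane
(typer g57), on director-ym g23 №599 (3): *"is `B6.Prop26Printed` typed for the VECTOR (bond) operator with
projection on T_η, and does any decl carry the p.248 Dirichlet sentence? if not: ONE addendum named fact
`B6.Prop26DirichletPrinted` (cite p.248 l.4–5 + p.228 l.23–35, gap tag G-B6-02-TRANSFER)"*; prestaged by the
records desk iface-1 g183 (`lit-balaban-iface-1/desk/B6Prop26DirichletPrinted.prestage.g183.lean`), lifted here.

TREE LOCATE (first-hand).  `B6.Prop26Printed` (`B6.lean`) quantifies over an ABSTRACT family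
`G : ∀ i, GFamily (geo i)` — the operator "seen through" the quantities of (2.136)–(2.140); the operator itself
(the vector Δ_a⁻¹ on T_η with the projection term ∂P∂*, or the compression G(Ω) = (ΩΔ_aΩ)⁻¹) is NOT visible in
the type and is fixed only when a consumer instantiates the family (e.g. `B9FromB6.DictAtOne`, the Ω₀-Dirichlet
family at U = 1).  The p. 248 sentence is carried (i) in DOCSTRINGS (`B6.Prop26Printed`: "holds also for G(Ω) with
Dirichlet conditions, p. 248"; the `B6GOmega.lean` and `B9FromB6.lean` headers, verbatim) and (ii) as ONE typed
hypothesis SLOT by name, `B6Carve46SectCHyp.Hyp.prop26Ω : B6.Prop26Printed X.geoΩ X.GΩ`, over that bundle's second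
family `Carriers.{IΩ, geoΩ, GΩ}` "indexed by IΩ = (geometry, Ω ⊃ Ω₁)" — i.e. `B6.Prop26Printed` AT THE
(geometry, Ω)-indexed family; there is no standalone citable named fact with its own cite tag and explicit
domain binders.  This file adds exactly that, and nothing else.

CONTENT.  The addendum below is an INSTANCE SHAPE of the existing decl with ONE piece of content beyond an alias:
the constants (M₁, δ₃, C, C(α), C(ε), C(α,ε)) are UNIFORM over the admissible Dirichlet domains Ω ⊃ Ω₁ of each
geometry (print: "with minor and obvious changes", p. 228; "Let us also repeat once more that this theorem holds
for the operators G(Ω) with Dirichlet boundary conditions on Ω^c, Ω ⊃ Ω₁", p. 248 ll. 4–5; consumer side [B9]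
CMP 99 p. 399 ll. 1–3 "the constants in the formulations of both theorems do not depend on the sequence {Ω_j}").
The kernel-checked lemma `prop26Dirichlet_iff_sigma` shows it IS `Prop26Printed` over the Σ-index of
(geometry, admissible domain) pairs (the device of `B6Carve46SectCHyp.Carriers.IΩ`) — so the named fact adds a cite
tag, a name and the uniformity reading, not new mathematics; `prop26Printed_of_dirichlet` slices it back to
`Prop26Printed` at any fixed admissible domain per index.  ASSERTED in print, not displayed: cell GAPS tag
G-B6-02-TRANSFER (bookkeeping twin: the compression principle `B6GOmega.hyp56_compress` ∕ `cutFamily_uniform`).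
An undischarged printed assertion, displayed BY NAME wherever used as a hypothesis; net debt +1, said so.
No `sorry`, no `instance`, no `notation`, no attribute manipulation; imports `…B6` only. -/

namespace Literature.MathematicalPhysics.QuantumFieldTheory.Balaban1983to89.B6

/-- **Prop. 2.6 for the Dirichlet operators G(Ω)** (p. 228 [PDF 6] after (2.35) + p. 248 [PDF 26] l.4–5,
verbatim): *"We will consider operators with Dirichlet boundary conditions on Ω^c. … G(Ω) = (Δ_a↾Ω)⁻¹ =
(ΩΔ_aΩ)⁻¹ … All the reasonings and the results of this paper hold, with minor and obvious changes, for the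
operators G(Ω). We choose Ω = T_η for simplicity of notation."* — *"Let us also repeat once more that this
theorem holds for the operators G(Ω) with Dirichlet boundary conditions on Ω^c, Ω ⊃ Ω₁."*  Typed: for every
index i a type `Dom i` of domains with an admissibility predicate `adm i` (Ω ⊃ Ω₁, a union of big blocks of T₁,
e.g. dist to Ω₁ ≤ RM) and the family `GΩ i Ω` = G(Ω) seen through (2.136)–(2.140); the inequalities hold with
constants depending on d, L only — the SAME for all admissible Ω.  ASSERTED in print, not displayed
(gap G-B6-02-TRANSFER; tree bookkeeping `B6GOmega`; the same sentence as a hypothesis slot by name: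
`B6Carve46SectCHyp.Hyp.prop26Ω`, typed as `Prop26Printed` at a (geometry, Ω)-indexed family). [cite: Balaban1984PropagatorsII, p.228 after (2.35); p.248 l.4-5 after Prop. 2.6] -/
def Prop26DirichletPrinted {I : Type} (geo : I → Geometry) (Dom : I → Type) (adm : ∀ i, Dom i → Prop)
    (GΩ : ∀ i, Dom i → GFamily (geo i)) : Prop :=
  ∃ M₁ δ₃ C : ℝ, ∃ Cα Cε : ℝ → ℝ, ∃ Cαε : ℝ → ℝ → ℝ, 0 < M₁ ∧ 0 < δ₃ ∧ 0 < C ∧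
    ∀ i : I, (geo i).Hyp21_22 → M₁ ≤ (geo i).M → ∀ Ω : Dom i, adm i Ω →
      Ineq2136_2140 (GΩ i Ω) C Cα Cε Cαε δ₃

/-- Bookkeeping (kernel-checked): the Dirichlet addendum is literally `Prop26Printed` over the Σ-index of
(geometry index, admissible domain) pairs — the index device of `B6Carve46SectCHyp.Carriers.IΩ`.  Bookkeeping. [cite: Balaban1984PropagatorsII, p.248 l.4-5 (bookkeeping)] -/
theorem prop26Dirichlet_iff_sigma {I : Type} (geo : I → Geometry) (Dom : I → Type)
    (adm : ∀ i, Dom i → Prop) (GΩ : ∀ i, Dom i → GFamily (geo i)) :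
    Prop26DirichletPrinted geo Dom adm GΩ ↔
      Prop26Printed (fun p : (Σ i, {Ω : Dom i // adm i Ω}) => geo p.1)
        (fun p => GΩ p.1 p.2.1) := by
  constructor
  · rintro ⟨M₁, δ₃, C, Cα, Cε, Cαε, hM, hδ, hC, H⟩
    exact ⟨M₁, δ₃, C, Cα, Cε, Cαε, hM, hδ, hC, fun p h21 hMp => H p.1 h21 hMp p.2.1 p.2.2⟩
  · rintro ⟨M₁, δ₃, C, Cα, Cε, Cαε, hM, hδ, hC, H⟩
    exact ⟨M₁, δ₃, C, Cα, Cε, Cαε, hM, hδ, hC, fun i h21 hMi Ω hΩ => H ⟨i, ⟨Ω, hΩ⟩⟩ h21 hMi⟩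

/-- Bookkeeping (kernel-checked): at the torus domain (any fixed admissible Ω₀ per index, e.g. Ω = T_η itself or
[B9]'s Ω₀ of p. 394) the addendum gives back `Prop26Printed` for that slice.  Bookkeeping. [cite: Balaban1984PropagatorsII, p.248 l.4-5 (bookkeeping)] -/
theorem prop26Printed_of_dirichlet {I : Type} (geo : I → Geometry) (Dom : I → Type)
    (adm : ∀ i, Dom i → Prop) (GΩ : ∀ i, Dom i → GFamily (geo i))
    (Ω₀ : ∀ i, Dom i) (h₀ : ∀ i, adm i (Ω₀ i))
    (h : Prop26DirichletPrinted geo Dom adm GΩ) :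
    Prop26Printed geo (fun i => GΩ i (Ω₀ i)) := by
  obtain ⟨M₁, δ₃, C, Cα, Cε, Cαε, hM, hδ, hC, H⟩ := h
  exact ⟨M₁, δ₃, C, Cα, Cε, Cαε, hM, hδ, hC, fun i h21 hMi => H i h21 hMi (Ω₀ i) (h₀ i)⟩

end Literature.MathematicalPhysics.QuantumFieldTheory.Balaban1983to89.B6
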